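import Mathlib.Analysis.SpecialFunctions.ExpDeriv
import Mathlib.Analysis.Calculus.Deriv.MeanValue
import Mathlib.Analysis.Calculus.Deriv.Pow
import Mathlib.Analysis.Complex.Exponential
import Mathlib.Tactic
import HarnessLib

/-!
# `e^y ≤ 1 + y + y²/2 + y³/c` on an initial segment (Mossinghoff–Trudgian 2015 §4; MTY 2024 §9)

Topic: `Literature/Analysis/SpecialFunctions`. Kadiri's method for the explicit classical
zero-free region of `ζ` bounds the integral `M(z, θ) = ∫₀^{d₁(θ)} |h_θ''(u)| e^{-zu} du` through the
moments `M_k(θ)` using a cubic majorant of the exponential: Mossinghoff–Trudgian, *J. Number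
Theory* 157 (2015), §4 ("the fact that `e^y ≤ 1 + y + y²/2 + y³/3.45` for `0 ≤ y ≤ 1.91094…`
implies that we may take `M*(z,θ) = M₀(θ) − M₁(θ)z + M₂(θ)z²/2 − M₃(θ)z³/3.45`"), and
Mossinghoff–Trudgian–Yang, *Res. Number Theory* 10 (2024), §9, third bullet ("we use the
inequality `e^y ≤ 1 + y + y²/2 + y³/3.47`, which is valid for `d₁(θ) ≤ 1.89355` …; in
[Mossinghoff–Trudgian 2015] the value `3.45` was used in place of `3.47`"). Both printed
inequalities are PROVED here (they are tight: at the right endpoints the slack is `2.3·10⁻⁶` and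
`1.2·10⁻⁶`):

* `exp_le_taylorCubic_of_endpoint` — the mechanism, for any `c > 0`: if the inequality holds at
  `Y`, it holds on `[0, Y]`. Proof: `ψ(u) = e^{-u}(1 + u + u²/2 + u³/c)` has
  `ψ'(u) = e^{-u} u² (3 − c/2 − u)/c` (`hasDerivAt_exp_neg_mul_taylorCubic`), so `ψ` increases on
  `[0, 3 − c/2]` and decreases on `[3 − c/2, ∞)`; hence `ψ ≥ min(ψ(0), ψ(Y)) = min(1, ψ(Y)) ≥ 1`
  on `[0, Y]`.
* `exp_le_taylorCubic_345` (`c = 3.45`, `0 ≤ y ≤ 1.91094`) and `exp_le_taylorCubic_347`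
  (`c = 3.47`, `0 ≤ y ≤ 1.89355`): the endpoint values `e^Y` are certified from Mathlib's
  `Real.exp_bound'` at `Y/2` with ten terms and `e^Y = (e^{Y/2})²`, by `norm_num` on rationals.

Part of the decomposition of the named fact
`Literature.NumberTheory.LFunctions.zero_free_region_mossinghoff_trudgian_yang` (MTY Theorem 1.3;
see `Literature/NumberTheory/LFunctions/ExplicitZeroFreeRegion.lean`). No named facts here.

## References

* M. J. Mossinghoff, T. S. Trudgian, *Nonnegative trigonometric polynomials and a zero-free region
  for the Riemann zeta-function*, J. Number Theory 157 (2015) 329–349 = arXiv:1410.3926, §4.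
  [cite: MossinghoffTrudgian2015]
* M. J. Mossinghoff, T. S. Trudgian, A. Yang, *Explicit zero-free regions for the Riemann
  zeta-function*, Res. Number Theory 10 (2024), no. 11 = arXiv:2212.06867, §9.
  [cite: MossinghoffTrudgianYangRNT2024]
-/

namespace Literature.Analysis.SpecialFunctions

open Set

/-- `ψ_c(u) = e^{-u}(1 + u + u²/2 + u³/c)` has derivative `e^{-u} · u²(3 − c/2 − u)/c` (`c ≠ 0`):
`ψ' = e^{-u}(P' − P)` with `P' − P = 3u²/c − u²/2 − u³/c`. [folklore] -/
theorem hasDerivAt_exp_neg_mul_taylorCubic {c : ℝ} (hc : c ≠ 0) (u : ℝ) :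
    HasDerivAt (fun x : ℝ ↦ Real.exp (-x) * (1 + x + x ^ 2 / 2 + x ^ 3 / c))
      (Real.exp (-u) * (u ^ 2 * (3 - c / 2 - u) / c)) u := by
  have h1 : HasDerivAt (fun x : ℝ ↦ Real.exp (-x)) (Real.exp (-u) * -1) u := (hasDerivAt_neg u).exp
  have h2 : HasDerivAt (fun x : ℝ ↦ 1 + x + x ^ 2 / 2 + x ^ 3 / c)
      (0 + 1 + (2 : ℕ) * u ^ (2 - 1) / 2 + (3 : ℕ) * u ^ (3 - 1) / c) u :=
    (((hasDerivAt_const u (1 : ℝ)).fun_add (hasDerivAt_id' u)).fun_add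
      ((hasDerivAt_pow 2 u).div_const 2)).fun_add ((hasDerivAt_pow 3 u).div_const c)
  refine (h1.fun_mul h2).congr_deriv ?_
  norm_num
  field_simp
  ring

/-- **The mechanism.** For `c > 0`: if `e^Y ≤ 1 + Y + Y²/2 + Y³/c`, then
`e^y ≤ 1 + y + y²/2 + y³/c` for all `0 ≤ y ≤ Y`. Indeed `ψ(u) = e^{-u}(1 + u + u²/2 + u³/c)` is
monotone on `[0, 3 − c/2]` and antitone on `[3 − c/2, ∞)` (sign of `ψ'`,
`hasDerivAt_exp_neg_mul_taylorCubic`), so on `[0, Y]` it is at least `min(ψ(0), ψ(Y)) ≥ 1`.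
This is how the printed ranges `y ≤ 1.91094` (`c = 3.45`) and `y ≤ 1.89355` (`c = 3.47`) arise:
they sit just below the first positive root of `e^y = 1 + y + y²/2 + y³/c`.
[cite: MossinghoffTrudgian2015, §4] [cite: MossinghoffTrudgianYangRNT2024, §9] -/
theorem exp_le_taylorCubic_of_endpoint {c Y y : ℝ} (hc : 0 < c)
    (hY : Real.exp Y ≤ 1 + Y + Y ^ 2 / 2 + Y ^ 3 / c) (h0 : 0 ≤ y) (hyY : y ≤ Y) :
    Real.exp y ≤ 1 + y + y ^ 2 / 2 + y ^ 3 / c := by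
  have hder := hasDerivAt_exp_neg_mul_taylorCubic hc.ne'
  have hcont : Continuous (fun x : ℝ ↦ Real.exp (-x) * (1 + x + x ^ 2 / 2 + x ^ 3 / c)) :=
    continuous_iff_continuousAt.2 fun u ↦ (hder u).continuousAt
  -- `ψ(y) ≥ 1`
  have hψy : 1 ≤ Real.exp (-y) * (1 + y + y ^ 2 / 2 + y ^ 3 / c) := by
    rcases le_total y (3 - c / 2) with hle | hge
    · -- `ψ` is monotone on `[0, 3 − c/2]`, and `ψ(0) = 1`
      have hmono : MonotoneOn (fun x : ℝ ↦ Real.exp (-x) * (1 + x + x ^ 2 / 2 + x ^ 3 / c))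
          (Icc 0 (3 - c / 2)) := by
        refine monotoneOn_of_deriv_nonneg (convex_Icc _ _) hcont.continuousOn
          (fun u _ ↦ (hder u).differentiableAt.differentiableWithinAt) ?_
        intro u hu
        rw [interior_Icc] at hu
        rw [(hder u).deriv]
        have hu' : 0 ≤ 3 - c / 2 - u := by linarith [hu.2]
        exact mul_nonneg (Real.exp_pos _).le (div_nonneg (mul_nonneg (sq_nonneg u) hu') hc.le)
      have h := hmono ⟨le_rfl, h0.trans hle⟩ ⟨h0, hle⟩ h0
      simpa using h
    · -- `ψ` is antitone on `[3 − c/2, ∞)`, and `ψ(Y) ≥ 1` by hypothesis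
      have hanti : AntitoneOn (fun x : ℝ ↦ Real.exp (-x) * (1 + x + x ^ 2 / 2 + x ^ 3 / c))
          (Ici (3 - c / 2)) := by
        refine antitoneOn_of_deriv_nonpos (convex_Ici _) hcont.continuousOn
          (fun u _ ↦ (hder u).differentiableAt.differentiableWithinAt) ?_
        intro u hu
        rw [interior_Ici] at hu
        rw [(hder u).deriv]
        have hu' : 0 ≤ u - (3 - c / 2) := by linarith [mem_Ioi.1 hu]
        have : Real.exp (-u) * (u ^ 2 * (3 - c / 2 - u) / c)
            = -(Real.exp (-u) * (u ^ 2 * (u - (3 - c / 2)) / c)) := by ring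
        rw [this, neg_nonpos]
        exact mul_nonneg (Real.exp_pos _).le (div_nonneg (mul_nonneg (sq_nonneg u) hu') hc.le)
      have h := hanti (mem_Ici.2 hge) (mem_Ici.2 (hge.trans hyY)) hyY
      have hψY : 1 ≤ Real.exp (-Y) * (1 + Y + Y ^ 2 / 2 + Y ^ 3 / c) := by
        have := mul_le_mul_of_nonneg_left hY (Real.exp_pos (-Y)).le
        rwa [← Real.exp_add, neg_add_cancel, Real.exp_zero] at this
      exact hψY.trans (by simpa using h)
  -- multiply by `e^y > 0`: `e^y ψ(y) = 1 + y + y²/2 + y³/c`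
  have hmul := mul_le_mul_of_nonneg_left hψy (Real.exp_pos y).le
  rw [mul_one, ← mul_assoc, ← Real.exp_add, add_neg_cancel, Real.exp_zero, one_mul] at hmul
  exact hmul

/-- `e^{1.91094} ≤ 1 + Y + Y²/2 + Y³/3.45` at `Y = 1.91094` (slack `2.3·10⁻⁶`): `e^{Y/2}` from
`Real.exp_bound'` with ten terms, squared. [cite: MossinghoffTrudgian2015, §4] -/
theorem exp_le_taylorCubic_345_endpoint :
    Real.exp 1.91094 ≤ 1 + 1.91094 + 1.91094 ^ 2 / 2 + 1.91094 ^ 3 / 3.45 := by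
  have hx0 : (0 : ℝ) ≤ 0.95547 := by norm_num
  have hx1 : (0.95547 : ℝ) ≤ 1 := by norm_num
  have hb := Real.exp_bound' hx0 hx1 (n := 10) (by norm_num)
  have hpos : 0 ≤ Real.exp 0.95547 := (Real.exp_pos _).le
  have hsq := mul_le_mul hb hb hpos (hpos.trans hb)
  have h2 : Real.exp 1.91094 = Real.exp 0.95547 * Real.exp 0.95547 := by
    rw [← Real.exp_add]; norm_num
  rw [h2]
  refine hsq.trans ?_
  simp only [Finset.sum_range_succ, Finset.sum_range_zero, Nat.factorial]
  norm_num

/-- **Mossinghoff–Trudgian 2015, §4:** `e^y ≤ 1 + y + y²/2 + y³/3.45` for `0 ≤ y ≤ 1.91094`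
("for `0 ≤ y ≤ 1.91094…`" in the source; the first positive root of equality is `1.910943…`).
[cite: MossinghoffTrudgian2015, §4] -/
theorem exp_le_taylorCubic_345 {y : ℝ} (h0 : 0 ≤ y) (h1 : y ≤ 1.91094) :
    Real.exp y ≤ 1 + y + y ^ 2 / 2 + y ^ 3 / 3.45 :=
  exp_le_taylorCubic_of_endpoint (by norm_num) exp_le_taylorCubic_345_endpoint h0 h1

/-- `e^{1.89355} ≤ 1 + Y + Y²/2 + Y³/3.47` at `Y = 1.89355` (slack `1.2·10⁻⁶`): `e^{Y/2}` from
`Real.exp_bound'` with ten terms, squared. [cite: MossinghoffTrudgianYangRNT2024, §9] -/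
theorem exp_le_taylorCubic_347_endpoint :
    Real.exp 1.89355 ≤ 1 + 1.89355 + 1.89355 ^ 2 / 2 + 1.89355 ^ 3 / 3.47 := by
  have hx0 : (0 : ℝ) ≤ 0.946775 := by norm_num
  have hx1 : (0.946775 : ℝ) ≤ 1 := by norm_num
  have hb := Real.exp_bound' hx0 hx1 (n := 10) (by norm_num)
  have hpos : 0 ≤ Real.exp 0.946775 := (Real.exp_pos _).le
  have hsq := mul_le_mul hb hb hpos (hpos.trans hb)
  have h2 : Real.exp 1.89355 = Real.exp 0.946775 * Real.exp 0.946775 := by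
    rw [← Real.exp_add]; norm_num
  rw [h2]
  refine hsq.trans ?_
  simp only [Finset.sum_range_succ, Finset.sum_range_zero, Nat.factorial]
  norm_num

/-- **Mossinghoff–Trudgian–Yang 2024, §9 (third bullet):** `e^y ≤ 1 + y + y²/2 + y³/3.47` for
`0 ≤ y ≤ 1.89355` (the source: "valid for `d₁(θ) ≤ 1.89355`"; the first positive root of
equality is `1.893551…`). [cite: MossinghoffTrudgianYangRNT2024, §9] -/
theorem exp_le_taylorCubic_347 {y : ℝ} (h0 : 0 ≤ y) (h1 : y ≤ 1.89355) :
    Real.exp y ≤ 1 + y + y ^ 2 / 2 + y ^ 3 / 3.47 :=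
  exp_le_taylorCubic_of_endpoint (by norm_num) exp_le_taylorCubic_347_endpoint h0 h1

end Literature.Analysis.SpecialFunctions
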